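import Literature.AlgebraicGeometry.Hu2025.Proofs.S05ThetaBlowups.Disp516

/-!
# Hu 2025 §5.4 Prop. 5.16 — KERNEL DISCHARGE on the typed carrier (row 106d): the printed LIST of relations lies in the
# honest chart ideal of `Ṽ_{ϑ[k]} ∩ 𝔙` (the «⊆» half of what joint J3 = G-H2 reads)

M-HU PREP by res-type-023 (gen 9), 2026-08-27 — FILED by res-type-055 (gen 9) as PARTITION-HU §3b HELPER for the row-106 owner res-type-023 (author of record; res-plan-2 IDLE POOL DEAL #4b 2026-08-27T08:54:38Z; helper TAKING 08:56:19Z, no objection) from the owner's deposited copy of record HOME/plan/tools/res-type-023/hu/file/SpanLe516.lean sha16 bab79327bff5e6c8, UNCHANGED except this filing note; S files R106aCharts = p513406 · R106cThetaBlowups = p518536 · R106dThetaEquations = p521266; Proofs chain Charts = p514775 · Prop511 = p519351 · Prop511L = p523180 · Cor518 = p524076 · Disp516Word = p524851 · Disp516 = p525463 (target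
`Literature/AlgebraicGeometry/Hu2025/Proofs/S05ThetaBlowups/SpanLe516.lean`, kind proof, after rows 106a–d + Disp516 land). Theorems
about OUR carriers; nothing of [Hu25] is asserted. AI work, weaker than expert review.

`Prop5_16_1 Φ R` (row 106d) reads: `Φ.idealVTilde R c (j+1) = Ideal.span (Φ.equationsAt R c j)` — LEFT the OURS carrier (the strict
transform of the ideal `idealV0` of `𝒱 ∩ 𝔙_[0]`, iterated along the word = «Ṽ_{ϑ[k]} is the proper transform of 𝒱», C38L49–L54), RIGHT
the manuscript's LIST (C38L134–L145 / C39L1–L12). PROVED HERE, on every frame satisfying `IsStandard` (i)/(iv), every ring, word,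
block: `Ideal.span (Φ.equationsAt R c j) ≤ Φ.idealVTilde R c (j+1)` (`span_equationsAt_le_idealVTilde`) — every listed relation
(the Def. 5.13 term-wise transforms of `𝓑^𝔯𝔟`, `𝓑^gov_{<k}`, `𝓑^gov_{>k}`, `𝓑^ngv_{>k}`, the pull-backs `𝓛_{<k}`, `𝓛_{>k}`, and the
DISPLAYED block-`F_k` relations, which by `Disp516` are the transforms of `B_(kτ)` and `L_{F_k}`) lies in the strict transform,
because `ζ^{l_{φ,B}} · B_𝔙 = π^* B_𝔙'` at every step (`ChartStep.properTransform_toPoly_mem_strictTransform`). The reverse inclusion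
— that the list GENERATES the strict transform of the ideal — is the inference adjudicated at J3 and is not touched here.
-/

noncomputable section

open MvPolynomial

namespace Literature.AlgebraicGeometry.Hu2025.Statements.S05ThetaBlowups

universe u v

variable {R : Type u} [CommRing R] {V : Type v} [DecidableEq V]

namespace ChartStep

variable (s : ChartStep V)

/-- `ζⁿ · g ∈ π^* I ⟹ g ∈ strict(I)`.
[cite: Hu2025, Prop. 5.16, pp. 89–92 (unrefereed preprint arXiv:2507.21400v1 under adjudication, D-0012/D-0089 — kernel support on OUR typed carrier of row 106; nothing of the source asserted)] -/
theorem mem_strictTransform_of_excVar_pow_mul_mem {I : Ideal (MvPolynomial V R)} {g : MvPolynomial V R} (n : ℕ)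
    (hg : X s.exc ^ n * g ∈ I.map (s.pullback (R := R))) : g ∈ s.strictTransform (R := R) I := by
  unfold strictTransform
  refine (le_iSup (fun n : ℕ => (I.map (s.pullback (R := R))).colon ({s.excVar (R := R) ^ n} : Set (MvPolynomial V R))) n) ?_
  rw [Submodule.mem_colon_singleton, smul_eq_mul, excVar_eq, mul_comm]
  exact hg

/-- The ζ-exponent of a pulled-back term is `m_{φ,T}` (C35L21–L22), hence at least `l_{φ,B}`.
[cite: Hu2025, Prop. 5.16, pp. 89–92 (unrefereed preprint arXiv:2507.21400v1 under adjudication, D-0012/D-0089 — kernel support on OUR typed carrier of row 106; nothing of the source asserted)] -/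
theorem pullbackExp_apply_exc (T : V →₀ ℕ) : s.pullbackExp T s.exc = phiDeg s.centre T := by
  simp only [pullbackExp, Finsupp.coe_add, Pi.add_apply, Finsupp.single_eq_same, phiDeg]
  rw [← Finset.add_sum_erase _ _ s.exc_mem]

/-- `ζ^l · (x^{π^*T} / ζ^l) = x^{π^*T}` for `l ≤ m_{φ,T}`.
[cite: Hu2025, Prop. 5.16, pp. 89–92 (unrefereed preprint arXiv:2507.21400v1 under adjudication, D-0012/D-0089 — kernel support on OUR typed carrier of row 106; nothing of the source asserted)] -/
theorem X_pow_mul_monomial_tsub {T : V →₀ ℕ} {l : ℕ} (hl : l ≤ phiDeg s.centre T) :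
    X s.exc ^ l * monomial (s.pullbackExp T - Finsupp.single s.exc l) (1 : R) = monomial (s.pullbackExp T) 1 := by
  rw [X_pow_eq_monomial, monomial_mul, one_mul, add_tsub_cancel_of_le]
  exact Finsupp.single_le_iff.mpr (by rw [pullbackExp_apply_exc]; exact hl)

/-- **Def. 5.4 at ring level: `ζ^{l_{φ,B}} · B_𝔙 = π^*_{𝔙,𝔙'} B_𝔙'`** ((define-proper-t) C35L32–L34).
[cite: Hu2025, Prop. 5.16, pp. 89–92 (unrefereed preprint arXiv:2507.21400v1 under adjudication, D-0012/D-0089 — kernel support on OUR typed carrier of row 106; nothing of the source asserted)] -/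
theorem X_pow_mul_properTransform_toPoly (B : Binomial V) :
    X s.exc ^ lPhi s.centre B.plus B.minus * (s.properTransform B).toPoly (R := R) = s.pullback (R := R) (B.toPoly (R := R)) := by
  rw [Binomial.toPoly_eq, Binomial.toPoly_eq, mul_sub, map_sub, pullback_monomial, pullback_monomial]
  simp only [ChartStep.properTransform]
  rw [s.X_pow_mul_monomial_tsub (show lPhi s.centre B.plus B.minus ≤ phiDeg s.centre B.plus from min_le_left _ _),
    s.X_pow_mul_monomial_tsub (show lPhi s.centre B.plus B.minus ≤ phiDeg s.centre B.minus from min_le_right _ _)]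

/-- **One step: the term-wise proper transform of a binomial of `I` lies in the strict transform of `I`.**
[cite: Hu2025, Prop. 5.16, pp. 89–92 (unrefereed preprint arXiv:2507.21400v1 under adjudication, D-0012/D-0089 — kernel support on OUR typed carrier of row 106; nothing of the source asserted)] -/
theorem properTransform_toPoly_mem_strictTransform {I : Ideal (MvPolynomial V R)} {B : Binomial V}
    (hB : B.toPoly (R := R) ∈ I) : (s.properTransform B).toPoly (R := R) ∈ s.strictTransform (R := R) I :=
  s.mem_strictTransform_of_excVar_pow_mul_mem (lPhi s.centre B.plus B.minus)
    (by rw [X_pow_mul_properTransform_toPoly]; exact Ideal.mem_map_of_mem _ hB)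

end ChartStep

namespace ChartSeq

/-- Along a word: iterated term-wise transforms of a binomial of `I` lie in the iterated strict transform of `I`.
[cite: Hu2025, Prop. 5.16, pp. 89–92 (unrefereed preprint arXiv:2507.21400v1 under adjudication, D-0012/D-0089 — kernel support on OUR typed carrier of row 106; nothing of the source asserted)] -/
theorem properTransform_toPoly_mem_strictTransform (w : ChartSeq V) {I : Ideal (MvPolynomial V R)} {B : Binomial V}
    (hB : B.toPoly (R := R) ∈ I) :
    (ChartSeq.properTransform w B).toPoly (R := R) ∈ ChartSeq.strictTransform R w I := by
  induction w generalizing I B with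
  | nil => exact hB
  | cons s w ih => exact ih (s.properTransform_toPoly_mem_strictTransform hB)

/-- Along a word: the composite pull-back of an element of `I` lies in the iterated strict transform of `I`.
[cite: Hu2025, Prop. 5.16, pp. 89–92 (unrefereed preprint arXiv:2507.21400v1 under adjudication, D-0012/D-0089 — kernel support on OUR typed carrier of row 106; nothing of the source asserted)] -/
theorem pullback_mem_strictTransform (w : ChartSeq V) {I : Ideal (MvPolynomial V R)} {f : MvPolynomial V R} (hf : f ∈ I) :
    ChartSeq.pullback (R := R) w f ∈ ChartSeq.strictTransform R w I := by
  induction w generalizing I f with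
  | nil => exact hf
  | cons s w ih => rw [pullback_cons, strictTransform_cons]; exact ih (s.pullback_mem_strictTransform hf)

end ChartSeq

namespace ThetaFrame

variable {P : Type v} {Rs : Type v} [DecidableEq P] [DecidableEq Rs] (Φ : ThetaFrame P Rs)
variable (R : Type u) [CommRing R]

omit [DecidableEq P] [DecidableEq Rs] in
/-- Governing binomials of `𝔙_[0]` lie in the ideal of `𝒱 ∩ 𝔙_[0]` (reminder C36L57–L67). [cite: Hu2025, Prop. 5.16, pp. 89–92 (unrefereed preprint arXiv:2507.21400v1 under adjudication, D-0012/D-0089 — kernel support on OUR typed carrier of row 106; nothing of the source asserted)] -/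
theorem toPoly_mem_idealV0_of_mem_Bgov0 {B : Binomial (P ⊕ Rs)} (h : B ∈ Φ.Bgov0) : B.toPoly (R := R) ∈ Φ.idealV0 R :=
  Ideal.subset_span (Or.inl ⟨B, Or.inl (Or.inl h), rfl⟩)

omit [DecidableEq P] [DecidableEq Rs] in
/-- Non-governing binomials of `𝔙_[0]` lie in the ideal of `𝒱 ∩ 𝔙_[0]` (reminder C36L57–L67). [cite: Hu2025, Prop. 5.16, pp. 89–92 (unrefereed preprint arXiv:2507.21400v1 under adjudication, D-0012/D-0089 — kernel support on OUR typed carrier of row 106; nothing of the source asserted)] -/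
theorem toPoly_mem_idealV0_of_mem_Bngv0 {B : Binomial (P ⊕ Rs)} (h : B ∈ Φ.Bngv0) : B.toPoly (R := R) ∈ Φ.idealV0 R :=
  Ideal.subset_span (Or.inl ⟨B, Or.inl (Or.inr h), rfl⟩)

omit [DecidableEq P] [DecidableEq Rs] in
/-- 𝔯𝔟-binomials of `𝔙_[0]` lie in the ideal of `𝒱 ∩ 𝔙_[0]` (reminder C36L57–L67). [cite: Hu2025, Prop. 5.16, pp. 89–92 (unrefereed preprint arXiv:2507.21400v1 under adjudication, D-0012/D-0089 — kernel support on OUR typed carrier of row 106; nothing of the source asserted)] -/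
theorem toPoly_mem_idealV0_of_mem_rb {B : Binomial (P ⊕ Rs)} (h : B ∈ Φ.rb) : B.toPoly (R := R) ∈ Φ.idealV0 R :=
  Ideal.subset_span (Or.inl ⟨B, Or.inr h, rfl⟩)

omit [DecidableEq P] [DecidableEq Rs] in
/-- The linearized relations `L_{𝔙_[0],F}` lie in the ideal of `𝒱 ∩ 𝔙_[0]` (reminder C36L57–L67). [cite: Hu2025, Prop. 5.16, pp. 89–92 (unrefereed preprint arXiv:2507.21400v1 under adjudication, D-0012/D-0089 — kernel support on OUR typed carrier of row 106; nothing of the source asserted)] -/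
theorem lin0_mem_idealV0 (k : Fin Φ.N) : Φ.lin0 R k ∈ Φ.idealV0 R :=
  Ideal.subset_span (Or.inr ⟨k, rfl⟩)

/-- The Def. 5.13 transform of any listed binomial of `𝒱 ∩ 𝔙_[0]` lies in `Ṽ_{ϑ[k]} ∩ 𝔙` (typed carrier).
[cite: Hu2025, Prop. 5.16, pp. 89–92 (unrefereed preprint arXiv:2507.21400v1 under adjudication, D-0012/D-0089 — kernel support on OUR typed carrier of row 106; nothing of the source asserted)] -/
theorem transformB_toPoly_mem_idealVTilde (c : Φ.Chart) (k : ℕ) {B : Binomial (P ⊕ Rs)}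
    (hB : B.toPoly (R := R) ∈ Φ.idealV0 R) : (Φ.transformB c k B).toPoly (R := R) ∈ Φ.idealVTilde R c k :=
  ChartSeq.properTransform_toPoly_mem_strictTransform _ hB

/-- The Def. 5.13 transform of a governing binomial lies in the chart ideal of `Ṽ_{ϑ[k]} ∩ 𝔙`. [cite: Hu2025, Prop. 5.16, pp. 89–92 (unrefereed preprint arXiv:2507.21400v1 under adjudication, D-0012/D-0089 — kernel support on OUR typed carrier of row 106; nothing of the source asserted)] -/
theorem govAt_toPoly_mem (c : Φ.Chart) (k : ℕ) (j : Fin Φ.N) (τ : Fin (Φ.t j)) :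
    (Φ.govAt c k j τ).toPoly (R := R) ∈ Φ.idealVTilde R c k :=
  Φ.transformB_toPoly_mem_idealVTilde R c k (Φ.toPoly_mem_idealV0_of_mem_Bgov0 R ⟨⟨j, τ⟩, rfl⟩)

/-- The Def. 5.13 transform of a non-governing binomial lies in the chart ideal of `Ṽ_{ϑ[k]} ∩ 𝔙`. [cite: Hu2025, Prop. 5.16, pp. 89–92 (unrefereed preprint arXiv:2507.21400v1 under adjudication, D-0012/D-0089 — kernel support on OUR typed carrier of row 106; nothing of the source asserted)] -/
theorem ngvAt_toPoly_mem (c : Φ.Chart) (k : ℕ) (j : Fin Φ.N) {τ τ' : Fin (Φ.t j)} (hne : τ ≠ τ') :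
    (Φ.ngvAt c k j τ τ').toPoly (R := R) ∈ Φ.idealVTilde R c k :=
  Φ.transformB_toPoly_mem_idealVTilde R c k (Φ.toPoly_mem_idealV0_of_mem_Bngv0 R ⟨j, τ, τ', hne, rfl⟩)

/-- The pull-back `L_{𝔙,F}` lies in the chart ideal of `Ṽ_{ϑ[k]} ∩ 𝔙`. [cite: Hu2025, Prop. 5.16, pp. 89–92 (unrefereed preprint arXiv:2507.21400v1 under adjudication, D-0012/D-0089 — kernel support on OUR typed carrier of row 106; nothing of the source asserted)] -/
theorem linAt_mem (c : Φ.Chart) (k : ℕ) (j : Fin Φ.N) : Φ.linAt R c k j ∈ Φ.idealVTilde R c k :=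
  ChartSeq.pullback_mem_strictTransform _ (Φ.lin0_mem_idealV0 R j)

/-- **Prop. 5.16, the «⊆» half on the typed carrier:** every relation of the printed list lies in the chart ideal of
`Ṽ_{ϑ[k]} ∩ 𝔙` (`k = j+1`), on every frame with `u_k` distinct and the block bookkeeping ((i), (iv) of `IsStandard`).
[cite: Hu2025, Prop. 5.16, pp. 89–92 (unrefereed preprint arXiv:2507.21400v1 under adjudication, D-0012/D-0089 — kernel support on OUR typed carrier of row 106; nothing of the source asserted)] -/
theorem span_equationsAt_le_idealVTilde (hult : Function.Injective Φ.ult) (hblk : ∀ k r, Φ.lead k = some r → Φ.blk r = k)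
    (hterm : ∀ k τ r, Φ.termR k τ = some r → Φ.blk r = k ∧ Φ.lead k ≠ some r) (c : Φ.Chart) (j : Fin Φ.N) :
    Ideal.span (Φ.equationsAt R c j) ≤ Φ.idealVTilde R c (j.val + 1) := by
  refine Ideal.span_le.mpr ?_
  rintro f (((((((⟨B, ⟨B₀, hB₀, rfl⟩, rfl⟩ | ⟨j', τ, -, rfl⟩) | ⟨j', -, rfl⟩) | ⟨τ, rfl⟩) | hf) | ⟨j', τ, -, rfl⟩) |
    ⟨j', τ, τ', -, hne, rfl⟩) | ⟨j', -, rfl⟩)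
  · exact Φ.transformB_toPoly_mem_idealVTilde R c _ (Φ.toPoly_mem_idealV0_of_mem_rb R hB₀)
  · exact Φ.govAt_toPoly_mem R c _ j' τ
  · exact Φ.linAt_mem R c _ j'
  · rw [Φ.dispGov_eq_govAt R hult hblk hterm]; exact Φ.govAt_toPoly_mem R c _ j τ
  · rw [Set.mem_singleton_iff.mp hf, Φ.dispLin_eq_linAt R hblk hterm]; exact Φ.linAt_mem R c _ j
  · exact Φ.govAt_toPoly_mem R c _ j' τ
  · exact Φ.ngvAt_toPoly_mem R c _ j' hne
  · exact Φ.linAt_mem R c _ j'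

/-- The same under `Φ.IsStandard`.
[cite: Hu2025, Prop. 5.16, pp. 89–92 (unrefereed preprint arXiv:2507.21400v1 under adjudication, D-0012/D-0089 — kernel support on OUR typed carrier of row 106; nothing of the source asserted)] -/
theorem span_equationsAt_le_idealVTilde_of_isStandard (hstd : Φ.IsStandard) (c : Φ.Chart) (j : Fin Φ.N) :
    Ideal.span (Φ.equationsAt R c j) ≤ Φ.idealVTilde R c (j.val + 1) :=
  Φ.span_equationsAt_le_idealVTilde R hstd.1 hstd.2.2.2.1 hstd.2.2.2.2.1 c j

end ThetaFrame

end Literature.AlgebraicGeometry.Hu2025.Statements.S05ThetaBlowups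

end

/-!
# Hu 2025 §5.1 Def. 5.4 — KERNEL DISCHARGE on the typed carrier (row 106a): the printed-name operation `Def5_4` (division of
# the pull-back by `ζ^{l_{φ,B}}` in `R[Var_𝔙]`, Mathlib `divMonomial`) IS the exponent-level `ChartStep.properTransform` used by
# all the proof files, and `span {Def5_4} ≤ Def5_4_ours` (the «⊆» half of what joint J3 = G-H2 compares, in the J3 vocabulary)

M-HU PREP by res-type-023 (gen 9), 2026-08-27 — FILED by res-type-055 (gen 9) as PARTITION-HU §3b HELPER for the row-106 owner res-type-023 (author of record; res-plan-2 IDLE POOL DEAL #4b 2026-08-27T08:54:38Z; helper TAKING 08:56:19Z, no objection) from the owner's deposited copy of record HOME/plan/tools/res-type-023/hu/file/SpanLe516.lean sha16 bab79327bff5e6c8, UNCHANGED except this filing note; S files R106aCharts = p513406 · R106cThetaBlowups = p518536 · R106dThetaEquations = p521266; Proofs chain Charts = p514775 · Prop511 = p519351 · Prop511L = p523180 · Cor518 = p524076 · Disp516Word = p524851 · Disp516 = p525463 (target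
merged into this file `…/Proofs/S05ThetaBlowups/SpanLe516.lean`, kind proof). Theorems about OUR carriers of
row 106a (`R106aCharts`); nothing of [Hu25] is asserted. AI work, weaker than expert review.

* `ChartStep.properTransformPoly_eq` / `Def5_4_eq_toPoly`: `Def5_4 R s B = (s.properTransform B).toPoly` — the module docstring of
  `R106aCharts` («Rendering choices») promised this agreement as a kernel fact; here it is ((define-proper-t) C35L32–L34:
  `B_𝔙 = (π^* B_𝔙') / ζ^{l_{φ,B_𝔙'}}`, with `ζ^{l} · B_𝔙 = π^* B_𝔙'` from `SpanLe516`).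
* `span_Def5_4_le_Def5_4_ours`: for any set `E'` of binomial equations on `𝔙'`, the ideal generated by their term-wise proper
  transforms `Def5_4 R s B` is CONTAINED in `Def5_4_ours R s (toPoly '' E')` (the ζ-saturated strict transform of the ideal they
  generate). Equality — the list generating the strict transform — is the inference adjudicated at J3 (G-H2); not touched.
-/

noncomputable section

open MvPolynomial

namespace Literature.AlgebraicGeometry.Hu2025.Statements.S05ThetaBlowups

universe u v

variable {R : Type u} [CommRing R] {V : Type v} [DecidableEq V]

namespace ChartStep

variable (s : ChartStep V)

/-- **`(π^* B) / ζ^{l_{φ,B}}` computed in `R[Var_𝔙]` equals the exponent-level proper transform.**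
[cite: Hu2025, Def. 5.4, p. 80 (unrefereed preprint arXiv:2507.21400v1 under adjudication, D-0012/D-0089 — kernel support on OUR typed carrier of row 106; nothing of the source asserted)] -/
theorem properTransformPoly_eq (B : Binomial V) :
    s.properTransformPoly (R := R) B = (s.properTransform B).toPoly (R := R) := by
  rw [properTransformPoly, ← s.X_pow_mul_properTransform_toPoly, X_pow_eq_monomial, divMonomial_monomial_mul]

end ChartStep

/-- **Definition 5.4 under its printed name = the exponent-level operation:** `Def5_4 R s B = (s.properTransform B).toPoly`.
[cite: Hu2025, Def. 5.4, p. 80 (unrefereed preprint arXiv:2507.21400v1 under adjudication, D-0012/D-0089 — kernel support on OUR typed carrier of row 106; nothing of the source asserted)] -/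
theorem Def5_4_eq_toPoly (s : ChartStep V) (B : Binomial V) :
    Def5_4 R s B = (s.properTransform B).toPoly (R := R) :=
  s.properTransformPoly_eq B

/-- **`ζ^{l_{φ,B}} · Def5_4 R s B = Def5_4_poly R s B_𝔙'`:** the binomial clause and the general-polynomial clause («the pullback»)
of Def. 5.4 differ exactly by the factor `ζ^{l_{φ,B}}` (C35L32–L42).
[cite: Hu2025, Def. 5.4, p. 80 (unrefereed preprint arXiv:2507.21400v1 under adjudication, D-0012/D-0089 — kernel support on OUR typed carrier of row 106; nothing of the source asserted)] -/
theorem X_pow_mul_Def5_4 (s : ChartStep V) (B : Binomial V) :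
    X s.exc ^ lPhi s.centre B.plus B.minus * Def5_4 R s B = Def5_4_poly R s (B.toPoly (R := R)) := by
  rw [Def5_4_eq_toPoly, s.X_pow_mul_properTransform_toPoly]
  rfl

/-- **The «⊆» half in the J3 vocabulary of row 106a:** the term-wise proper transforms of a set of binomial equations generate an
ideal CONTAINED in the strict transform of the ideal the equations generate (`Def5_4_ours`).
[cite: Hu2025, Def. 5.4, p. 80 (unrefereed preprint arXiv:2507.21400v1 under adjudication, D-0012/D-0089 — kernel support on OUR typed carrier of row 106; nothing of the source asserted)] -/
theorem span_Def5_4_le_Def5_4_ours (s : ChartStep V) (E' : Set (Binomial V)) :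
    Ideal.span ((fun B => Def5_4 R s B) '' E') ≤ Def5_4_ours R s ((fun B => B.toPoly (R := R)) '' E') := by
  refine Ideal.span_le.mpr ?_
  rintro _ ⟨B, hB, rfl⟩
  show Def5_4 R s B ∈ s.strictTransform (R := R) _
  rw [Def5_4_eq_toPoly]
  exact s.properTransform_toPoly_mem_strictTransform (Ideal.subset_span ⟨B, hB, rfl⟩)

/-!
## A kernel CRITERION for the «⊇» half (what J3 = G-H2 adjudicates), per blow-up step: SATURATION

For one step `s` (exceptional variable `ζ`) and ideals `I` (old chart) and `J` (new chart): if `π^* I ⊆ J ⊆ strict(I)` and `J` is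
`ζ`-saturated (`(J : ζ) ⊆ J`), then `J = strict(I)` (`ChartStep.strictTransform_eq_of_saturated`). On the frame: the typed
`Prop5_16_1` at block `j` on the chart `c` FOLLOWS from (i) the pull-backs of the level-`j` relations lie in the span of the level-`(j+1)`
list and (ii) that span is `ζ_j`-saturated (`ThetaFrame.prop5_16_1_at_of_saturated`; «⊆» is `span_equationsAt_le_idealVTilde`). This
only REFORMULATES the inference in standard commutative algebra (saturation = `ζ` is a non-zero-divisor modulo the listed relations);
it asserts nothing about whether (i)/(ii) hold for [Hu25]'s equations. OURS; AI work.
-/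

namespace ChartStep

variable (s : ChartStep V)

/-- If `(J : z) ≤ J` then `(J : zⁿ) ≤ J` for every `n` (elementary colon-ideal induction; file-local helper —
made `private` and tagged at filing by the helper res-type-055 for the gate lints `lint.tags`/`lint.literature-cited-only`;
statement and proof = the owner's deposit). [folklore] -/
private theorem colon_pow_le_of_colon_le {A : Type u} [CommRing A] {J : Ideal A} {z : A}
    (hsat : J.colon ({z} : Set A) ≤ J) : ∀ n : ℕ, J.colon ({z ^ n} : Set A) ≤ J := by
  intro n
  induction n with
  | zero =>
    intro x hx
    rw [Submodule.mem_colon_singleton, smul_eq_mul, pow_zero, mul_one] at hx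
    exact hx
  | succ n ih =>
    intro x hx
    rw [Submodule.mem_colon_singleton, smul_eq_mul, pow_succ', ← mul_assoc] at hx
    have hxz : x * z ∈ J.colon ({z ^ n} : Set A) := by
      rw [Submodule.mem_colon_singleton, smul_eq_mul]; exact hx
    have hxz' : x * z ∈ J := ih hxz
    exact hsat (by rw [Submodule.mem_colon_singleton, smul_eq_mul]; exact hxz')

/-- **Saturation criterion for one step:** if `π^* I ⊆ J` and `J` is `ζ`-saturated then `strict(I) ⊆ J`.
[cite: Hu2025, Def. 5.4 / Prop. 5.16, pp. 80, 89 (unrefereed preprint arXiv:2507.21400v1 under adjudication, D-0012/D-0089 — OURS criterion in standard commutative algebra on the typed carrier; nothing of the source asserted)] -/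
theorem strictTransform_le_of_saturated {I J : Ideal (MvPolynomial V R)} (hIJ : I.map (s.pullback (R := R)) ≤ J)
    (hsat : J.colon ({X s.exc} : Set (MvPolynomial V R)) ≤ J) : s.strictTransform (R := R) I ≤ J := by
  unfold strictTransform
  refine iSup_le fun n => ?_
  intro x hx
  rw [excVar_eq] at hx
  exact colon_pow_le_of_colon_le hsat n (Submodule.colon_mono hIJ le_rfl hx)

/-- **`strict(I) = J`** when `π^* I ⊆ J ⊆ strict(I)` and `J` is `ζ`-saturated.
[cite: Hu2025, Def. 5.4 / Prop. 5.16, pp. 80, 89 (unrefereed preprint arXiv:2507.21400v1 under adjudication, D-0012/D-0089 — OURS criterion; nothing of the source asserted)] -/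
theorem strictTransform_eq_of_saturated {I J : Ideal (MvPolynomial V R)} (hIJ : I.map (s.pullback (R := R)) ≤ J)
    (hJ : J ≤ s.strictTransform (R := R) I) (hsat : J.colon ({X s.exc} : Set (MvPolynomial V R)) ≤ J) :
    s.strictTransform (R := R) I = J :=
  le_antisymm (s.strictTransform_le_of_saturated hIJ hsat) hJ

end ChartStep

namespace ThetaFrame

variable {P : Type v} {Rs : Type v} [DecidableEq P] [DecidableEq Rs] (Φ : ThetaFrame P Rs) (R : Type u) [CommRing R]

/-- `Ṽ_{ϑ[j+1]} ∩ 𝔙` from `Ṽ_{ϑ[j]} ∩ 𝔙'`: one strict transform at the step of block `j` (if present on the chart) — the «Alternatively»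
construction C38L52–L54 on the typed carrier.
[cite: Hu2025, (fV diagram) C38L41–L54, p. 88 (unrefereed preprint arXiv:2507.21400v1 under adjudication, D-0012/D-0089 — kernel support on OUR carrier; nothing of the source asserted)] -/
theorem idealVTilde_succ (c : Φ.Chart) (j : Fin Φ.N) :
    Φ.idealVTilde R c (j.val + 1) =
      (Φ.step c j).elim (Φ.idealVTilde R c j.val) fun s => s.strictTransform (R := R) (Φ.idealVTilde R c j.val) := by
  simp only [idealVTilde, seq_succ]
  cases Φ.step c j with
  | none => simp [ChartSeq.strictTransform]
  | some s => simp [ChartSeq.strictTransform, List.foldl_append]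

/-- **The typed `Prop5_16_1` at block `j` on the chart `c`, FROM SATURATION:** if the step at block `j` is present (`s`), the
pull-backs of the chart ideal of `Ṽ_{ϑ[j]} ∩ 𝔙'` lie in the span of the level-`(j+1)` list, and that span is `ζ_j`-saturated, then
`idealVTilde R c (j+1) = Ideal.span (equationsAt R c j)` — on a frame with `IsStandard` (i)(iv) (for the «⊆» half). What J3 asks of
[Hu25]'s equations is exactly (i) + (ii); the theorem does not claim they hold.
[cite: Hu2025, Prop. 5.16, pp. 89–92 (unrefereed preprint arXiv:2507.21400v1 under adjudication, D-0012/D-0089 — OURS reformulation of the adjudicated inference; nothing of the source asserted)] -/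
theorem prop5_16_1_at_of_saturated (hstd : Φ.IsStandard) (c : Φ.Chart) (j : Fin Φ.N) {s : ChartStep (P ⊕ Rs)}
    (hstep : Φ.step c j = some s)
    (hpull : (Φ.idealVTilde R c j.val).map (s.pullback (R := R)) ≤ Ideal.span (Φ.equationsAt R c j))
    (hsat : (Ideal.span (Φ.equationsAt R c j)).colon ({X s.exc} : Set (MvPolynomial (P ⊕ Rs) R)) ≤
      Ideal.span (Φ.equationsAt R c j)) :
    Φ.idealVTilde R c (j.val + 1) = Ideal.span (Φ.equationsAt R c j) := by
  have hle := Φ.span_equationsAt_le_idealVTilde_of_isStandard R hstd c j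
  rw [Φ.idealVTilde_succ R c j, hstep, Option.elim_some] at hle ⊢
  exact s.strictTransform_eq_of_saturated hpull hle hsat

end ThetaFrame

end Literature.AlgebraicGeometry.Hu2025.Statements.S05ThetaBlowups

end
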